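import Summits.BirchSwinnertonDyer.BirchSwinnertonDyer.Theses.CyclotomicUntwist
import Summits.BirchSwinnertonDyer.BirchSwinnertonDyer.Theses.SemiOrdinaryEisensteinDescent
import Summits.BirchSwinnertonDyer.BirchSwinnertonDyer.Theses.KatoDescentPotSupersingular
import Summits.BirchSwinnertonDyer.BirchSwinnertonDyer.Theorems.CyclotomicUntwistPSTwistStability
import Summits.BirchSwinnertonDyer.BirchSwinnertonDyer.Theorems.WildThreeRankOneBSDpOfExactIndexManin
import Summits.BirchSwinnertonDyer.BirchSwinnertonDyer.Theorems.SchneiderFreeAdditiveX3UpperReceptacle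
import Summits.BirchSwinnertonDyer.BirchSwinnertonDyer.Theorems.ClassRecordThreeStepLOfHalvesB
import Literature.NumberTheory.EllipticCurves.BSDHeegnerPointsGrossZagierProofs
import Literature.NumberTheory.EllipticCurves.KrizLi2019.SexticTwistBSDThreeDescent
import Literature.NumberTheory.EllipticCurves.GlobalMinimalModelProofs
import Literature.NumberTheory.EllipticCurves.ModularCurveManinConstantProofs
import Literature.NumberTheory.EllipticCurves.NonEisensteinPrimeOfSurjective
import HarnessLib

/-!
# Route `CyclotomicUntwist` IN ITS OWN ROW CURRENCY: K1 / K2 on the principal-series rows from SOED's one-sided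
# cruxes and the OPPOSITE half of the rank-ZERO principal-series rows — the rank-zero wild leaf
# `WAllExclAddWildRankZero` (SOED's Z, K9's whole rank-zero conjunct) replaced by a PS-row HALF (cross-route kernels)

Cell `bsd-wall` (W-ALL, row 2 @3), prover seat `bsd-line-cycu-p3` (g0), 2026-08-27. HONEST FRAMING: CONDITIONAL
kernels — every crux / half named below is an ANTECEDENT; closes nothing; BSD₃ for no curve; 0 definitions, 0
named facts, 0 `sorry`.

The companion kernels (`CyclotomicUntwistPSRankOne{Upper,Lower}HalfAtThreeOfSOED`) feed the Gross–Zagier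
bookkeeping over `(E, E^{(d_K)})` with the FULL `BSD₃` of the rank-zero twist, taken from the wild rank-zero leaf Z.
Only ONE half of the twist is used each time (upper half of `E` ⟸ joint upper + LOWER half of `E^{(d_K)}`; lower
half of `E` ⟸ joint lower + UPPER half of `E^{(d_K)}`), and by `CyclotomicUntwistPS.ps_iff_of_heegner_twist` the
minimal model of `E^{(d_K)}` is again a PRINCIPAL-SERIES row (Δ_min ∈ (ℚ₃^×)² transports along a twist by the
`3`-adic square `d_K`). So route CU can be read in its own row currency:

* §1 **`upperHalf_psTowerRows_of_kolyvaginCrux_of_psRankZeroLowerHalf`** — published inputs ∧ SOED Ko ∧ «LOWER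
  half on the rank-ZERO PS rows (non-CM, `ClassO6`, `E[3]` irreducible, PS, `r_an = 0`)» ⟹ the UPPER half on the
  tower-surjective rank-one PS rows; §2 `psRankOneUpperHalfAtThree_of_kolyvaginCrux_of_psRankZeroLowerHalf_of_psNonTowerUpperHalf`
  — add «UPPER half on the non-tower rank-one PS rows» ⟹ CU's K2 `PSRankOneUpperHalfAtThree` BY NAME; §3 the
  same with the rank-zero lower half taken BY NAME from K9's crux `WildLowerHalfRankZero` (item 19195, L₀) and the
  non-tower part from SOED's NT: **`psRankOneUpperHalfAtThree_of_kolyvaginCrux_of_wildLowerHalfRankZero_of_nonTower :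
  PublishedInputsWildThree → WildKolyvaginUpperAtThree → WildLowerHalfRankZero → WildRankOneSurjNonTowerAtThree →
  PSRankOneUpperHalfAtThree`** (three routes, one DAG edge each).
* §4 **`lowerHalf_psRows_of_eisenstein_of_waldspurger_of_control_of_psRankZeroUpperHalf`** — published inputs ∧
  SOED E ∧ V ∧ C ∧ «UPPER half on the rank-ZERO PS rows» ⟹ the LOWER half on every rank-one PS row; §5
  **`psRankOneLowerHalfAtThree_of_eisenstein_of_waldspurger_of_control_of_psRankZeroUpperHalf`** ⟹ CU's deciding
  crux K1 BY NAME.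

The rank-zero PS halves are displayed `∀`-hypotheses (no new definition) with the IMAGE binder `E[3]` IRREDUCIBLE
rather than onto: irreducibility is what the tree transports along a quadratic twist (`X11b.irr_of_twist`; onto ⟹
irreducible, `hasIrreducibleModPGaloisRep_of_hasSurjectiveModNGaloisRep`), and the route's census lists 0
irreducible-not-onto PS classes. PLANNER-LEVEL READING (bookkeeping, not a ruling): (i) the rank-zero partner CU
needs is a PS row, so a CU-internal rank-zero companion «PS r_an = 0: lower half» (the finite-slope road's own
rank-zero output — Kato IMC₃ Wan-direction for the untwist reads `L(E,1)` as well) would make K2 ⟸ Ko + that +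
NT-upper with NO wild-leaf import; (ii) K1 ⟸ E + V + C + «PS r_an = 0: upper half», the latter being K9's DERIVED
U₀ on the PS rows (Kato 14.5 (3) under (12.5.2) off the defect rows). BSD is not proved by any of this.

References: [GrossZagier1986] Thm. I.(6.3), (7.3), V.§2; [JetchevSkinnerWan2017] §7.4.1 (arXiv:1512.06894 p. 30);
[Castella2018] Thm. 2.3, §5; [FriedbergHoffstein1995] Thm. B; [Jetchev2008] Thm. 1.4; [Kato2004Asterisque]
Thm. 14.5 (3); [Miller2011LMS] Def. 1.1; [Serre1973] II §3.3; [Zywina2015] Prop. 1.14/1.16.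
-/

noncomputable section

open scoped Classical

set_option linter.dupNamespace false
set_option autoImplicit false

namespace Summit.BirchSwinnertonDyer.BirchSwinnertonDyer.Theorems.CyclotomicUntwistOfSOED

open WeierstrassCurve NumberField IsDedekindDomain Field
  Literature.NumberTheory.EllipticCurves
  Literature.NumberTheory.EllipticCurves.ModularForms
  Literature.NumberTheory.EllipticCurves.Rank1Residual
  Literature.NumberTheory.EllipticCurves.Rank1Residual.Typed
  Literature.NumberTheory.EllipticCurves.KrizLi2019
  Summit.BirchSwinnertonDyer.Rank1Residual
  Summit.BirchSwinnertonDyer.Rank1Residual.Additive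
  Summit.BirchSwinnertonDyer.Rank1Residual.X11b
  Summit.BirchSwinnertonDyer.Rank1Residual.X11b.AcSelmer
  Summit.BirchSwinnertonDyer.Rank1Residual.X11b.Halves
  Summit.BirchSwinnertonDyer.BirchSwinnertonDyer.Theses.SemiOrdinaryEisensteinDescent
  Summit.BirchSwinnertonDyer.BirchSwinnertonDyer.Theses.KatoDescentPotSupersingular
  Summit.BirchSwinnertonDyer.BirchSwinnertonDyer.Theorems.CyclotomicUntwistPS

/-! ### §0 The Heegner twist of a PS row, as a row -/

/-- **Row data of the minimal Heegner twist of a PS row.** For `W` on `ClassO6 W 3` with `ρ̄_{E,3}` onto and the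
PS predicate, `K` imaginary quadratic Heegner for `N(E)` with `d_K` odd, and `Cd • W^{(d_K)} = Wd` globally minimal:
`Wd` is non-CM (`j(Wd) = j(W)`, Zywina), on `ClassO6 Wd 3` (`classO6_twist_of_heegner`), `Wd[3]` is irreducible
(`X11b.irr_of_twist`), `Wd` is a PS row (`ps_iff_of_heegner_twist`), and `L(E^{(d_K)},1) ≠ 0` gives `r_an(Wd) = 0`.
[cite: Zywina2015, Prop. 1.14 and Prop. 1.16] [cite: Serre1973, Ch. II §3.3 Thm 3] -/
theorem psRow_twist_of_heegner (W : WeierstrassCurve ℚ) [W.IsElliptic] [W.IsGloballyMinimal]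
    (hO6 : ClassO6 W 3) (hsurj : W.HasSurjectiveModNGaloisRep 3)
    (hev : Even (padicValInt 3 W.minimalDiscriminantInt))
    (hsq : W.minimalDiscriminantInt / 3 ^ padicValInt 3 W.minimalDiscriminantInt % 3 = 1)
    (K : Type) [Field K] [NumberField K] (hK : IsImaginaryQuadratic K) (hodd : Odd (NumberField.discr K))
    (hHN : SatisfiesHeegnerHypothesis (W.conductorNorm ℤ) K)
    (hLd : (W.quadraticTwist (NumberField.discr K : ℚ)).entireLFunction 1 ≠ 0)
    (Wd : WeierstrassCurve ℚ) [Wd.IsElliptic] [Wd.IsGloballyMinimal] (Cd : VariableChange ℚ)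
    (hCd : Cd • W.quadraticTwist (NumberField.discr K : ℚ) = Wd) :
    ¬ Wd.HasCM ∧ ClassO6 Wd 3 ∧ Wd.HasIrreducibleModPGaloisRep 3 ∧
      Even (padicValInt 3 Wd.minimalDiscriminantInt) ∧
      Wd.minimalDiscriminantInt / 3 ^ padicValInt 3 Wd.minimalDiscriminantInt % 3 = 1 ∧
      Wd.analyticRank = 0 := by
  obtain ⟨hO6d, hjd⟩ := classO6_twist_of_heegner W hO6 K hK hHN hodd Wd Cd hCd
  have hCM : ¬ W.HasCM := fun hCM ↦
    W.not_hasSurjectiveModNGaloisRep_of_hasCM hCM Nat.prime_three (by decide) hsurj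
  have hCMd : ¬ Wd.HasCM := fun h ↦ hCM ((hasCM_iff_of_j_eq hjd).mp h)
  have hD0 : (NumberField.discr K : ℚ) ≠ 0 := by exact_mod_cast NumberField.discr_ne_zero K
  haveI : (W.quadraticTwist (NumberField.discr K : ℚ)).IsElliptic := W.isElliptic_quadraticTwist hD0
  have hirr : W.HasIrreducibleModPGaloisRep 3 :=
    hasIrreducibleModPGaloisRep_of_hasSurjectiveModNGaloisRep W 3 hsurj
  have hirrd : Wd.HasIrreducibleModPGaloisRep 3 := X11b.irr_of_twist W hD0 Wd hCd hirr
  have h3N : 3 ∣ W.conductorNorm ℤ :=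
    (W.dvd_conductorNorm_iff_not_hasGoodReductionAtPrime 3).mpr (not_good_of_addv W 3 hO6.2.1)
  have hps : Even (padicValInt 3 Wd.minimalDiscriminantInt) ∧
      Wd.minimalDiscriminantInt / 3 ^ padicValInt 3 Wd.minimalDiscriminantInt % 3 = 1 :=
    (ps_iff_of_heegner_twist W h3N K hK hHN Wd hCd).mpr ⟨hev, hsq⟩
  have hLd1 : Wd.entireLFunction 1 ≠ 0 := by rw [← hCd, entireLFunction_smul]; exact hLd
  have hrd : Wd.analyticRank = 0 := analyticRank_eq_zero_of_entireLFunction_one_ne_zero Wd hLd1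
  exact ⟨hCMd, hO6d, hirrd, hps.1, hps.2, hrd⟩

/-! ### §1 K2 currency: the UPPER half on the tower rows from Ko and the rank-zero PS LOWER half -/

/-- **UPPER half on the `3`-adic-tower-surjective rank-one PS rows ⟸ published inputs ∧ SOED's Kolyvagin crux Ko
∧ the LOWER half on the rank-ZERO PS rows.** Same data as the companion kernel (parity, Friedberg–Hoffstein mod
`2`, Heegner point, Gross–Zagier, Ko = co-STEP L at slack `v₃(c)`, `Upper.jointUpperBoundAt_of_coStepL_manin`), but
the partner's lower half is asked of the displayed rank-zero PS hypothesis at the minimal twist, which §0 shows IS a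
rank-zero PS row. CONDITIONAL; no `p`-adic input; no wild-leaf import. [cite: GrossZagier1986, Thm. I.(6.3) and (7.3)]
[cite: FriedbergHoffstein1995, Thm. B] [cite: JetchevSkinnerWan2017, §7.4.1 (arXiv:1512.06894 p. 30)]
[cite: Jetchev2008, Thm. 1.4] -/
theorem upperHalf_psTowerRows_of_kolyvaginCrux_of_psRankZeroLowerHalf (hF : PublishedInputsWildThree)
    (hKoly : WildKolyvaginUpperAtThree)
    (hL0 : ∀ (Wd : WeierstrassCurve ℚ) [Wd.IsElliptic] [Wd.IsGloballyMinimal],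
      ¬ Wd.HasCM → ClassO6 Wd 3 → Wd.HasIrreducibleModPGaloisRep 3 →
      Even (padicValInt 3 Wd.minimalDiscriminantInt) →
      Wd.minimalDiscriminantInt / 3 ^ padicValInt 3 Wd.minimalDiscriminantInt % 3 = 1 →
      Wd.analyticRank = 0 → MissingLowerBoundAt Wd 3)
    (W : WeierstrassCurve ℚ) [W.IsElliptic] [W.IsGloballyMinimal]
    (hO6 : ClassO6 W 3) (hsurj : W.HasSurjectiveModNGaloisRep 3) (htower : AdditiveThree.TowerSurjThree W)
    (hev : Even (padicValInt 3 W.minimalDiscriminantInt))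
    (hsq : W.minimalDiscriminantInt / 3 ^ padicValInt 3 W.minimalDiscriminantInt % 3 = 1)
    (hr : W.analyticRank = 1) : MissingUpperBoundAt W 3 := by
  obtain ⟨hGZ, hKo, hGZK, hmod, -, -, hGZ73, hFH, hpar, hHP⟩ := hF
  haveI hN0 : NeZero (W.conductorNorm ℤ) := ⟨W.conductorNorm_pos_holds.ne'⟩
  have hw : W.rootNumber = -1 := by
    rcases W.rootNumber_eq_one_or with h | h
    · exfalso
      have heven : Even W.analyticRank := (hpar W).mpr h
      rw [hr] at heven
      exact Nat.not_even_one heven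
    · exact h
  obtain ⟨K, _, _, hK, -, hHN, hH2, hLt⟩ := hFH W hw 2 two_ne_zero 0
  have hodd : Odd (NumberField.discr K) := by
    have h8 := Literature.SatisfiesHeegnerHypothesis.discr_emod_eight hK.1 hH2 (dvd_refl 2)
    rw [Int.odd_iff]; omega
  have h3N : 3 ∣ W.conductorNorm ℤ :=
    (W.dvd_conductorNorm_iff_not_hasGoodReductionAtPrime 3).mpr (not_good_of_addv W 3 hO6.2.1)
  have hd3 : NumberField.discr K ≠ -3 := by
    intro h
    exact Literature.SatisfiesHeegnerHypothesis.not_dvd_discr hK.1 hHN Nat.prime_three h3N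
      (by rw [h]; norm_num)
  have hwK : ¬ 3 ∣ Units.torsionOrder K :=
    (X11b.Three.not_dvd_discr_and_not_dvd_torsionOrder_of_heegner hK hHN (by decide) h3N).2
  obtain ⟨P, Dt, H, ι, hP⟩ := hHP W K hK hHN
  have hLone : W.entireLFunction 1 = 0 := entireLFunction_one_eq_zero_of_analyticRank_eq_one hr
  obtain ⟨-, hderiv⟩ := leadingLCoeff_eq_deriv_of_analyticRank_eq_one hr
  have hLK : LDerivEK W K ≠ 0 := by
    rw [lDerivEK_eq_deriv_mul W K hmod hLone]; exact mul_ne_zero hderiv hLt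
  have hnt : ¬ IsOfFinAddOrder P :=
    (lDerivEK_ne_zero_iff_not_isOfFinAddOrder W (W.conductorNorm ℤ) K (hGZ _ W K) hK hHN
      ⟨Dt, H, ι, hP⟩).mp hLK
  have hupI : SchneiderFree.Upper.IndexUpperBoundLeAt W 3 K P (padicValNat 3 Dt.c.natAbs) :=
    hKoly W (W.conductorNorm ℤ) K Dt H ι P hO6 hsurj hr rfl hK hHN hLt hP hnt hodd hd3 htower
  have hD0 : (NumberField.discr K : ℚ) ≠ 0 := by exact_mod_cast NumberField.discr_ne_zero K
  haveI : (W.quadraticTwist (NumberField.discr K : ℚ)).IsElliptic := W.isElliptic_quadraticTwist hD0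
  obtain ⟨Cd, hCd⟩ := hasGlobalMinimalModel_rat_holds (W.quadraticTwist (NumberField.discr K : ℚ))
  haveI : (Cd • W.quadraticTwist (NumberField.discr K : ℚ)).IsGloballyMinimal := hCd
  -- the minimal twist is a rank-zero PS row: its LOWER half from the displayed hypothesis
  obtain ⟨hCMd, hO6d, hirrd, hevd, hsqd, hrd⟩ := psRow_twist_of_heegner W hO6 hsurj hev hsq K hK hodd hHN hLt
    (Cd • W.quadraticTwist (NumberField.discr K : ℚ)) Cd rfl
  have hdlo : MissingLowerBoundAt (Cd • W.quadraticTwist (NumberField.discr K : ℚ)) 3 :=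
    hL0 _ hCMd hO6d hirrd hevd hsqd hrd
  exact SchneiderFree.Upper.missingUpperBoundAt_of_jointUpper_of_lower
    (SchneiderFree.Upper.jointUpperBoundAt_of_coStepL_manin hGZ hKo hGZK hmod hGZ73 W 3
      (W.conductorNorm ℤ) K Dt H ι P (Cd • W.quadraticTwist (NumberField.discr K : ℚ)) hr rfl h3N hK
      hodd hwK hHN hLt hP ⟨Cd, rfl⟩ (by decide) hupI) hdlo

/-! ### §2 CU's K2 BY NAME in PS-row currency -/

/-- **K2 `PSRankOneUpperHalfAtThree` (stmt-BirchSwinnertonDyer-21581) ⟸ published inputs ∧ SOED Ko ∧ «LOWER half on the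
rank-zero PS rows» ∧ «UPPER half on the non-tower rank-one PS rows».** On the tower rows §1; off them the displayed
non-tower hypothesis (CU's binders verbatim plus `¬ TowerSurjThree`). CONDITIONAL cross-route kernel; closes nothing;
BSD is not proved by this. [cite: JetchevSkinnerWan2017, §7.4.1 (arXiv:1512.06894 p. 30)] [cite: Jetchev2008, Thm. 1.4] -/
theorem psRankOneUpperHalfAtThree_of_kolyvaginCrux_of_psRankZeroLowerHalf_of_psNonTowerUpperHalf
    (hF : PublishedInputsWildThree) (hKoly : WildKolyvaginUpperAtThree)
    (hL0 : ∀ (Wd : WeierstrassCurve ℚ) [Wd.IsElliptic] [Wd.IsGloballyMinimal],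
      ¬ Wd.HasCM → ClassO6 Wd 3 → Wd.HasIrreducibleModPGaloisRep 3 →
      Even (padicValInt 3 Wd.minimalDiscriminantInt) →
      Wd.minimalDiscriminantInt / 3 ^ padicValInt 3 Wd.minimalDiscriminantInt % 3 = 1 →
      Wd.analyticRank = 0 → MissingLowerBoundAt Wd 3)
    (hNTu : ∀ (W : WeierstrassCurve ℚ) [W.IsElliptic] [W.IsGloballyMinimal],
      ¬ W.HasCM → ClassO6 W 3 → W.HasSurjectiveModNGaloisRep 3 → ¬ AdditiveThree.TowerSurjThree W →
      Even (padicValInt 3 W.minimalDiscriminantInt) →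
      W.minimalDiscriminantInt / 3 ^ padicValInt 3 W.minimalDiscriminantInt % 3 = 1 →
      W.analyticRank = 1 → MissingUpperBoundAt W 3) :
    Summit.BirchSwinnertonDyer.BirchSwinnertonDyer.Theses.CyclotomicUntwist.PSRankOneUpperHalfAtThree := by
  intro W _ _ hncm hO6 hsurj hev hsq hr
  by_cases htower : AdditiveThree.TowerSurjThree W
  · exact upperHalf_psTowerRows_of_kolyvaginCrux_of_psRankZeroLowerHalf hF hKoly hL0 W hO6 hsurj htower hev hsq hr
  · exact hNTu W hncm hO6 hsurj htower hev hsq hr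

/-! ### §3 The same with K9's L₀ and SOED's NT by name -/

/-- **K2 ⟸ published inputs (SOED) ∧ Ko (SOED 20480) ∧ L₀ `WildLowerHalfRankZero` (K9 19195) ∧ NT (SOED 20484).**
K9's rank-zero LOWER half on the wild class carries no image or PS binder, so it pays the displayed rank-zero PS
hypothesis of §2; NT pays the non-tower upper half (it pays `BSD₃` there). Three routes, one edge each. CONDITIONAL;
closes nothing; BSD is not proved by this. [cite: JetchevSkinnerWan2017, §7.4.1 (arXiv:1512.06894 p. 30)]
[cite: Kato2004Asterisque, Conj. 12.10] [cite: Jetchev2008, Thm. 1.4] -/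
theorem psRankOneUpperHalfAtThree_of_kolyvaginCrux_of_wildLowerHalfRankZero_of_nonTower
    (hF : PublishedInputsWildThree) (hKoly : WildKolyvaginUpperAtThree) (hL0 : WildLowerHalfRankZero)
    (hNT : WildRankOneSurjNonTowerAtThree) :
    Summit.BirchSwinnertonDyer.BirchSwinnertonDyer.Theses.CyclotomicUntwist.PSRankOneUpperHalfAtThree := by
  refine psRankOneUpperHalfAtThree_of_kolyvaginCrux_of_psRankZeroLowerHalf_of_psNonTowerUpperHalf hF hKoly
    (fun Wd _ _ _ hO6d _ _ _ hrd ↦ hL0 Wd hrd hO6d) ?_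
  intro W _ _ hncm hO6 hsurj htower _ _ hr
  haveI : Finite W.sha := (hF.2.2.1 W (by omega)).2
  exact (lower_and_upper_of_missingPPartAt W 3 (missingPPartAt_of_bsdp W 3 (hNT W hncm hO6 hsurj htower hr))).2

/-! ### §4 K1 currency: the LOWER half on the PS rows from E, V, C and the rank-zero PS UPPER half -/

/-- **LOWER half on every rank-one PS row ⟸ published inputs ∧ SOED's Eisenstein crux E ∧ Waldspurger V ∧ control
C ∧ the UPPER half on the rank-ZERO PS rows.** Steps (a)–(b) of the SOED kernel verbatim (parity,
Friedberg–Hoffstein mod `2`, Heegner point, Gross–Zagier, Kolyvagin over `K`, frame `(κ, γ, 𝔭, 𝔭′)`, Waldspurger value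
at `𝔭`, control at `𝔭′`, Eisenstein inclusion ⟹ LOWER socket ⟹ STEP L), `Exact.jointLowerBoundAt_of_stepL_manin`,
and the partner's UPPER half from the displayed rank-zero PS hypothesis at the minimal twist (§0). CONDITIONAL; no
wild-leaf import, no tower split. [cite: JetchevSkinnerWan2017, §7.4.1 (arXiv:1512.06894 p. 30)]
[cite: Castella2018, Thm. 2.3 and §5 (5.1)–(5.3)] [cite: GrossZagier1986, Thm. I.(6.3) and V.§2]
[cite: FriedbergHoffstein1995, Thm. B] -/
theorem lowerHalf_psRows_of_eisenstein_of_waldspurger_of_control_of_psRankZeroUpperHalf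
    (hF : PublishedInputsWildThree) (hE : WildSplitEisensteinInclusionAtThree) (hV : WildSplitWaldspurgerAtThree)
    (hC : WildSplitControlAtThree)
    (hU0 : ∀ (Wd : WeierstrassCurve ℚ) [Wd.IsElliptic] [Wd.IsGloballyMinimal],
      ¬ Wd.HasCM → ClassO6 Wd 3 → Wd.HasIrreducibleModPGaloisRep 3 →
      Even (padicValInt 3 Wd.minimalDiscriminantInt) →
      Wd.minimalDiscriminantInt / 3 ^ padicValInt 3 Wd.minimalDiscriminantInt % 3 = 1 →
      Wd.analyticRank = 0 → MissingUpperBoundAt Wd 3)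
    (W : WeierstrassCurve ℚ) [W.IsElliptic] [W.IsGloballyMinimal]
    (hO6 : ClassO6 W 3) (hsurj : W.HasSurjectiveModNGaloisRep 3)
    (hev : Even (padicValInt 3 W.minimalDiscriminantInt))
    (hsq : W.minimalDiscriminantInt / 3 ^ padicValInt 3 W.minimalDiscriminantInt % 3 = 1)
    (hr : W.analyticRank = 1) : MissingLowerBoundAt W 3 := by
  obtain ⟨hGZ, hKo, hGZK, hmod, -, -, hGZ73, hFH, hpar, hHP⟩ := hF
  haveI hN0 : NeZero (W.conductorNorm ℤ) := ⟨W.conductorNorm_pos_holds.ne'⟩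
  -- (a) DATA
  have hw : W.rootNumber = -1 := by
    rcases W.rootNumber_eq_one_or with h | h
    · exfalso
      have heven : Even W.analyticRank := (hpar W).mpr h
      rw [hr] at heven
      exact Nat.not_even_one heven
    · exact h
  obtain ⟨K, _, _, hK, -, hHN, hH2, hLt⟩ := hFH W hw 2 two_ne_zero 0
  have hodd : Odd (NumberField.discr K) := by
    have h8 := Literature.SatisfiesHeegnerHypothesis.discr_emod_eight hK.1 hH2 (dvd_refl 2)
    rw [Int.odd_iff]; omega
  have h3N : 3 ∣ W.conductorNorm ℤ :=
    (W.dvd_conductorNorm_iff_not_hasGoodReductionAtPrime 3).mpr (not_good_of_addv W 3 hO6.2.1)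
  have hsplit : SplitsIn K 3 := hHN 3 Nat.prime_three h3N
  have hwK : ¬ 3 ∣ Units.torsionOrder K :=
    (X11b.Three.not_dvd_discr_and_not_dvd_torsionOrder_of_heegner hK hHN (by decide) h3N).2
  obtain ⟨P, Dt, H, ι, hP⟩ := hHP W K hK hHN
  have hLone : W.entireLFunction 1 = 0 := entireLFunction_one_eq_zero_of_analyticRank_eq_one hr
  obtain ⟨-, hderiv⟩ := leadingLCoeff_eq_deriv_of_analyticRank_eq_one hr
  have hLK : LDerivEK W K ≠ 0 := by
    rw [lDerivEK_eq_deriv_mul W K hmod hLone]; exact mul_ne_zero hderiv hLt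
  have hnt : ¬ IsOfFinAddOrder P :=
    (lDerivEK_ne_zero_iff_not_isOfFinAddOrder W (W.conductorNorm ℤ) K (hGZ _ W K) hK hHN
      ⟨Dt, H, ι, hP⟩).mp hLK
  obtain ⟨hrk, hfin⟩ := hKo (W.conductorNorm ℤ) W K hK hHN ⟨Dt, H, ι, hP⟩ hnt
  obtain ⟨κ, γ, -, hκ, hγ, -⟩ := X11b.exists_anticyclotomic_generator_prime (p := 3) hK
  haveI : Fact (κ.IsTopGenerator γ) := ⟨hγ⟩
  obtain ⟨𝔭, h𝔭, he, hf⟩ := X11b.exists_degreeOnePrime_of_splitsIn K 3 hK.1 hsplit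
  obtain ⟨𝔭', hne, h𝔭', he', hf'⟩ := X11b.Three.exists_ne_degreeOne_prime hK.1 h𝔭 he hf
  -- (b) PLUMBING
  obtain ⟨ι', hind, ΩK, Ωp, L, hΩK, hΩp, hBDP, u, hval⟩ :=
    hV W (W.conductorNorm ℤ) K Dt H ι P hO6 hsurj hr rfl hK hHN hLt hP hnt κ hκ γ 𝔭 h𝔭 he hf
  have hctl : SchneiderFree.AdditiveControlOnTreeAt 3 κ 𝔭' γ (embAt K 3 𝔭' h𝔭' he' hf') P :=
    hC W (W.conductorNorm ℤ) K Dt H ι P hO6 hsurj hr rfl hK hHN hLt hP hnt (hKo _ W K) κ hκ γ 𝔭'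
      h𝔭' he' hf'
  obtain ⟨n, hn, hneq⟩ := hctl
  have hincl : (XAc.charIdeal (W.baseChange K) 3 κ 𝔭' ∅ γ).map (PowerSeries.map (toUnr 3)) ≤
      Ideal.span {L} :=
    hE W (W.conductorNorm ℤ) K Dt hO6 hsurj hr rfl hK hHN κ hκ γ 𝔭 h𝔭 he hf 𝔭' h𝔭' hne ι' hind
      ΩK Ωp L hΩK hΩp hBDP hn.1
  have hval' : L.HasValueAt 0 ((((u : unrIntegers 3) : unrIntegers 3) : ℂ_[3]) *
      (algebraMap ℚ_[3] ℂ_[3]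
        (logOmega W 3 (embAt K 3 𝔭' h𝔭' he' hf') P / (Dt.c : ℚ_[3]))) ^ 2) :=
    (SchneiderFreeAdditiveX3.hasValueAt_sq_logOmega_embAt_iff_of_rank_one W 3 hK.1 hrk h𝔭 he hf
      h𝔭' he' hf' P _ _ L).mpr hval
  have hc0 : Dt.c ≠ 0 := Dt.maninConstant_ne_zero_holds
  have hlog : logOmega W 3 (embAt K 3 𝔭' h𝔭' he' hf') P ≠ 0 := X11b.R1.logOmega_ne_zero W 3 _ hnt
  have hlow : SchneiderFree.AdditiveIMCLowerBDPOnTreeLeAt 3 κ 𝔭' γ (embAt K 3 𝔭' h𝔭' he' hf')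
      (padicValNat 3 Dt.c.natAbs) P := by
    obtain ⟨htors, f, hfI, hf0, hfn⟩ := hn
    have hmem : PowerSeries.map (toUnr 3) f ∈ Ideal.span {L} := by
      have h3 := hincl
      rw [hfI, CongruenceLimit.map_span_singleton_powerSeries] at h3
      exact (Ideal.span_singleton_le_iff_mem _).mp h3
    obtain ⟨-, hle⟩ := Supersingular.two_mul_valuation_le_of_mem_span 3 hf0 hmem u hval'
    have hc0' : (Dt.c : ℚ_[3]) ≠ 0 := by exact_mod_cast hc0
    rw [div_eq_mul_inv, Padic.valuation_mul hlog (inv_ne_zero hc0'), Padic.valuation_inv,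
      Padic.valuation_intCast, valuation_logOmega hlog, hfn] at hle
    refine ⟨n, ⟨htors, f, hfI, hf0, hfn⟩, ?_⟩
    simp only [padicValInt] at hle
    linarith
  have hlo : SchneiderFree.IndexLowerBoundLeAt W 3 K P (padicValNat 3 Dt.c.natAbs) :=
    SchneiderFreeAdditiveX3.indexLowerBoundLeAt_of_imcLowerLe_of_control rfl hK hHN hfin hlow
      ⟨n, hn, hneq⟩
  -- (c) the minimal twist is a rank-zero PS row: its UPPER half from the displayed hypothesis
  have hD0 : (NumberField.discr K : ℚ) ≠ 0 := by exact_mod_cast NumberField.discr_ne_zero K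
  haveI : (W.quadraticTwist (NumberField.discr K : ℚ)).IsElliptic := W.isElliptic_quadraticTwist hD0
  obtain ⟨Cd, hCd⟩ := hasGlobalMinimalModel_rat_holds (W.quadraticTwist (NumberField.discr K : ℚ))
  haveI : (Cd • W.quadraticTwist (NumberField.discr K : ℚ)).IsGloballyMinimal := hCd
  obtain ⟨hCMd, hO6d, hirrd, hevd, hsqd, hrd⟩ := psRow_twist_of_heegner W hO6 hsurj hev hsq K hK hodd hHN hLt
    (Cd • W.quadraticTwist (NumberField.discr K : ℚ)) Cd rfl
  have hdup : MissingUpperBoundAt (Cd • W.quadraticTwist (NumberField.discr K : ℚ)) 3 :=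
    hU0 _ hCMd hO6d hirrd hevd hsqd hrd
  exact missingLowerBoundAt_of_joint_of_upper
    (SchneiderFree.Exact.jointLowerBoundAt_of_stepL_manin hGZ hKo hGZK hmod hGZ73 W 3 (W.conductorNorm ℤ)
      K Dt H ι P (Cd • W.quadraticTwist (NumberField.discr K : ℚ)) hr rfl h3N hK hodd hwK hHN hLt hP
      ⟨Cd, rfl⟩ (by decide) hlo) hdup

/-! ### §5 CU's K1 BY NAME in PS-row currency -/

/-- **K1 `PSRankOneLowerHalfAtThree` (stmt-BirchSwinnertonDyer-21580) ⟸ published inputs ∧ SOED E ∧ V ∧ C ∧ «UPPER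
half on the rank-zero PS rows (non-CM, `ClassO6`, `E[3]` irreducible, PS, `r_an = 0`)».** CU's `¬ HasCM` binder is
idle; its PS binders are USED (they make the twist a PS row). CONDITIONAL cross-route kernel; closes nothing; BSD is
not proved by this. [cite: JetchevSkinnerWan2017, §7.4.1 (arXiv:1512.06894 p. 30)] [cite: Castella2018, Thm. 2.3 and §5]
[cite: GrossZagier1986, Thm. I.(6.3) and V.§2] -/
theorem psRankOneLowerHalfAtThree_of_eisenstein_of_waldspurger_of_control_of_psRankZeroUpperHalf
    (hF : PublishedInputsWildThree) (hE : WildSplitEisensteinInclusionAtThree) (hV : WildSplitWaldspurgerAtThree)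
    (hC : WildSplitControlAtThree)
    (hU0 : ∀ (Wd : WeierstrassCurve ℚ) [Wd.IsElliptic] [Wd.IsGloballyMinimal],
      ¬ Wd.HasCM → ClassO6 Wd 3 → Wd.HasIrreducibleModPGaloisRep 3 →
      Even (padicValInt 3 Wd.minimalDiscriminantInt) →
      Wd.minimalDiscriminantInt / 3 ^ padicValInt 3 Wd.minimalDiscriminantInt % 3 = 1 →
      Wd.analyticRank = 0 → MissingUpperBoundAt Wd 3) :
    Summit.BirchSwinnertonDyer.BirchSwinnertonDyer.Theses.CyclotomicUntwist.PSRankOneLowerHalfAtThree := by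
  intro W _ _ _hncm hO6 hsurj hev hsq hr
  exact lowerHalf_psRows_of_eisenstein_of_waldspurger_of_control_of_psRankZeroUpperHalf hF hE hV hC hU0 W hO6
    hsurj hev hsq hr

end Summit.BirchSwinnertonDyer.BirchSwinnertonDyer.Theorems.CyclotomicUntwistOfSOED

end
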